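import Mathlib
import Summits.KontsevichZagierPeriods.Zeta5Search.DenomLaw.ThresholdModelCensus

/-!
# ζ(5) search — DENOM-LAW: the threshold model, PART II (the level census), part D: the integer dictionary `t(ℓ,u)`, centre zero, examples

Cell `pub-zeta5`, track DENOM-LAW (K1 typing order item (1), «ThresholdModel port»): denom-engine-d2 g12's kernel-checked scratch module
`denom-law/engine-d2/g12/lean/LevelCensus.lean` PART II (THRESHOLD-X4; Theorem S (i)/(i′) at cell level) filed VERBATIM in four parts
(≤ 400 lines each; split plan THRESHOLD-X4 §2; docstrings added where the scratch file had none) by denom-prover-d1 g5.  Part D of 4.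
HONEST FRAMING: systematic search; MODEL/structure side — elementary integer arithmetic of the level census; nothing about ζ(5); no γ; no irrationality claim; records in print UNMOVED.
The mathematical header of PART II (the census, what is proved) is the second module docstring of part A (`ThresholdModelCensus.lean`).
-/

namespace Summit.KontsevichZagierPeriods.Zeta5Search.DenomLaw.ThresholdModel.Rho

section Census
variable {p m b0 : ℤ} {b : Fin 7 → ℤ} {ℓ ℓ' u u' : ℤ}

/-- the INTEGER of level `ℓ` of the class `u`:  `t(ℓ,u) = (b₀ + 2 − u + p(2ℓ − 3m + 2))/2` (theory-d1 `census2`: the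
members of the residue class `x = t(0,u) mod p` are `x + p(ℓ + fl)`; `u = s2_x`). -/
def tOf (p m b0 ℓ u : ℤ) : ℤ := (b0 + 2 + dpos p m ℓ u) / 2

/-- `R₀` of the cell in b-coordinates. -/
def R0b (p m b0 : ℤ) : ℤ := b0 - (3 * m - 2) * p

/-- `ρ_j` of the cell in b-coordinates. -/
def rhob (p m b0 : ℤ) (b : Fin 7 → ℤ) : Fin 7 → ℤ := fun j => b0 - 2 * b j - (m - 1) * p

/-- `rhob` is Part I's `rhoOf` with `q = (m−1)p`. -/
theorem rhob_eq_rhoOf (p m b0 : ℤ) (b : Fin 7 → ℤ) : rhob p m b0 b = rhoOf ((m - 1) * p) b0 b := by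
  funext j; unfold rhob rhoOf; ring

/-- `R0b` is Part I's `R0Of` with `q = (m−1)p`. -/
theorem R0b_eq_R0Of (p m b0 : ℤ) : R0b p m b0 = R0Of p ((m - 1) * p) b0 := by
  unfold R0b R0Of; ring

/-- for a class (`u ≡ R₀ (mod 2)`) the doubled integer is exact: `2·t(ℓ,u) = b₀ + 2 + d(ℓ,u)` (no parity of `p` needed). -/
theorem two_mul_tOf (hc : (u - R0b p m b0) % 2 = 0) (ℓ : ℤ) : 2 * tOf p m b0 ℓ u = b0 + 2 + dpos p m ℓ u := by
  have e1 : b0 + 2 + dpos p m ℓ u = (b0 - (3 * m - 2) * p - u) + 2 * (p * ℓ + 1) := by unfold dpos; ring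
  unfold R0b at hc
  unfold tOf; rw [e1]; omega

/-- **block `j` contains `t(ℓ,u)` iff `BlockCov`** (`|2t − (b₀+2)| ≤ b₀ − 2b_j`). -/
theorem tOf_mem_block_iff (hc : (u - R0b p m b0) % 2 = 0) (j : Fin 7) :
    (b j + 1 ≤ tOf p m b0 ℓ u ∧ tOf p m b0 ℓ u ≤ b0 - b j + 1) ↔ BlockCov p m (rhob p m b0 b j) ℓ u := by
  have h2 := two_mul_tOf hc ℓ
  unfold BlockCov rhob
  rw [abs_le]
  constructor <;> rintro ⟨h0, h1⟩ <;> constructor <;> linarith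

/-- **the numerator contains `t(ℓ,u)` iff `NumCov`** (`|2t − (b₀+2)| ≤ b₀`). -/
theorem tOf_mem_num_iff (hc : (u - R0b p m b0) % 2 = 0) :
    (1 ≤ tOf p m b0 ℓ u ∧ tOf p m b0 ℓ u ≤ b0 + 1) ↔ NumCov p m (R0b p m b0) ℓ u := by
  have h2 := two_mul_tOf hc ℓ
  unfold NumCov R0b
  rw [abs_le]
  constructor <;> rintro ⟨h0, h1⟩ <;> constructor <;> linarith

/-- consecutive levels of one class differ by `p`. -/
theorem tOf_succ (hc : (u - R0b p m b0) % 2 = 0) (ℓ : ℤ) : tOf p m b0 (ℓ + 1) u = tOf p m b0 ℓ u + p := by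
  have h1 := two_mul_tOf hc ℓ
  have h2 := two_mul_tOf hc (ℓ + 1)
  have e : dpos p m (ℓ + 1) u = dpos p m ℓ u + 2 * p := by unfold dpos; ring
  omega

/-- the levels of a class run through ONE residue class mod `p`: `t(ℓ,u) = t(0,u) + p·ℓ`. -/
theorem tOf_eq_tOf_zero_add (hc : (u - R0b p m b0) % 2 = 0) (ℓ : ℤ) : tOf p m b0 ℓ u = tOf p m b0 0 u + p * ℓ := by
  have h1 := two_mul_tOf hc ℓ
  have h2 := two_mul_tOf hc 0
  have e : dpos p m ℓ u = dpos p m 0 u + 2 * (p * ℓ) := by unfold dpos; ring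
  omega

/-- … and every member of that residue class is a level: `t ≡ t(0,u) (mod p) ⟹ t = t(ℓ,u)` for some `ℓ`. -/
theorem exists_level_of_dvd (hc : (u - R0b p m b0) % 2 = 0) {t : ℤ} (ht : p ∣ t - tOf p m b0 0 u) :
    ∃ ℓ, tOf p m b0 ℓ u = t := by
  obtain ⟨k, hk⟩ := ht
  exact ⟨k, by rw [tOf_eq_tOf_zero_add hc k]; linarith⟩

/-- **(level, class) ↦ integer is INJECTIVE** on classes `u ∈ (−p, p]`: distinct pairs give distinct integers. -/
theorem tOf_inj (hp : 1 ≤ p) (hc : (u - R0b p m b0) % 2 = 0) (hc' : (u' - R0b p m b0) % 2 = 0)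
    (hu1 : -p < u) (hu2 : u ≤ p) (hu1' : -p < u') (hu2' : u' ≤ p) (h : tOf p m b0 ℓ u = tOf p m b0 ℓ' u') :
    ℓ = ℓ' ∧ u = u' := by
  have h1 := two_mul_tOf hc ℓ
  have h2 := two_mul_tOf hc' ℓ'
  have e : dpos p m ℓ u - dpos p m ℓ' u' = 2 * (p * ℓ) - 2 * (p * ℓ') - u + u' := by unfold dpos; ring
  have hd : 2 * (p * ℓ) - 2 * (p * ℓ') = u - u' := by linarith
  rcases lt_trichotomy ℓ ℓ' with hlt | heq | hgt
  · have : p * ℓ + p ≤ p * ℓ' := by nlinarith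
    exfalso; linarith
  · subst heq; exact ⟨rfl, by linarith⟩
  · have : p * ℓ' + p ≤ p * ℓ := by nlinarith
    exfalso; linarith

/-- **distinct classes are distinct residue classes mod p**: `t(0,u) ≡ t(0,u') (mod p) ⟹ u = u'`. -/
theorem class_eq_of_dvd (hp : 1 ≤ p) (hc : (u - R0b p m b0) % 2 = 0) (hc' : (u' - R0b p m b0) % 2 = 0)
    (hu1 : -p < u) (hu2 : u ≤ p) (hu1' : -p < u') (hu2' : u' ≤ p)
    (h : p ∣ tOf p m b0 0 u - tOf p m b0 0 u') : u = u' := by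
  obtain ⟨k, hk⟩ := h
  have h1 := two_mul_tOf hc 0
  have h2 := two_mul_tOf hc' 0
  have e : dpos p m 0 u - dpos p m 0 u' = u' - u := by unfold dpos; ring
  have hd : u' - u = 2 * (p * k) := by linarith
  rcases lt_trichotomy k 0 with hlt | heq | hgt
  · have : p * k ≤ -p := by nlinarith
    exfalso; linarith
  · subst heq; linarith
  · have : p ≤ p * k := by nlinarith
    exfalso; linarith

/-- **(level, class) ↦ integer is SURJECTIVE**: every integer `t` is `t(ℓ,u)` for some level `ℓ` and some class
`u ∈ (−p, p]`, `u ≡ R₀ (mod 2)` (with `tOf_inj`: the `p` classes partition ℤ, the levels enumerate each class). -/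
theorem tOf_surj (hp : 1 ≤ p) (t : ℤ) :
    ∃ ℓ u, -p < u ∧ u ≤ p ∧ (u - R0b p m b0) % 2 = 0 ∧ tOf p m b0 ℓ u = t := by
  set w : ℤ := 2 * t - b0 - 2 + 3 * (p * m) - p with hw
  have h2p : (0 : ℤ) < 2 * p := by linarith
  have hdiv := Int.mul_ediv_add_emod w (2 * p)
  have hs0 : 0 ≤ w % (2 * p) := Int.emod_nonneg _ (by linarith)
  have hs1 : w % (2 * p) < 2 * p := Int.emod_lt_of_pos _ h2p
  set q : ℤ := w / (2 * p) with hq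
  set s : ℤ := w % (2 * p) with hsdef
  have hs : s = w - 2 * p * q := by linarith
  have hc : (p - s - R0b p m b0) % 2 = 0 := by
    have e : p - s - R0b p m b0 = 2 * (p * q - t + 1) := by rw [hs, hw]; unfold R0b; ring
    rw [e]; omega
  refine ⟨q, p - s, by linarith, by linarith, hc, ?_⟩
  have h2 := two_mul_tOf hc q
  have e : b0 + 2 + dpos p m q (p - s) = 2 * t := by rw [hs, hw]; unfold dpos; ring
  omega

/-- **CENTRE-ZERO**: the centre `(b₀+2)/2` of the cell is the integer of level `ℓ` of class `u` iff `d(ℓ,u) = 0`; for a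
class `u ∈ (−p, p]` this happens (for some `ℓ`) iff `u = 0 ∧ m even` or `u = p ∧ m odd` — theory-d1's centre-zero
indicator `[2x ≡ b₀+2 (mod 2p)]`.  So on `b₀`-even cells (`R₀ ≡ m (mod 2)`) it is Part I's `centre` class `u ∈ {0, p}`, and
on `b₀`-odd cells there is NO centre-zero class although the self-mirror class `u ∈ {0,p}` exists (U2-LAW v3 §4 (D): the
«census-convention» cells where census and engine weights differ by this one unit). -/
theorem centreZero_iff (hp : 1 ≤ p) (hu1 : -p < u) (hu2 : u ≤ p) :
    (∃ ℓ, dpos p m ℓ u = 0) ↔ (u = 0 ∧ m % 2 = 0) ∨ (u = p ∧ m % 2 = 1) := by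
  constructor
  · rintro ⟨ℓ, hℓ⟩
    unfold dpos at hℓ
    -- u = p·k with k = 2ℓ − 3m + 2; |u| ≤ p forces k ∈ {0, 1}
    set k := 2 * ℓ - 3 * m + 2 with hk
    have hu : u = p * k := by linarith
    rcases lt_trichotomy k 0 with hlt | heq | hgt
    · have : p * k ≤ -p := by nlinarith
      exfalso; linarith
    · left; constructor
      · rw [hu, heq, mul_zero]
      · omega
    · by_cases hk1 : k = 1
      · right; constructor
        · rw [hu, hk1, mul_one]
        · omega
      · have hk2 : 2 ≤ k := by omega
        have : 2 * p ≤ p * k := by nlinarith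
        exfalso; linarith
  · rintro (⟨rfl, hm⟩ | ⟨rfl, hm⟩)
    · refine ⟨(3 * m - 2) / 2, ?_⟩
      unfold dpos
      have : 2 * ((3 * m - 2) / 2) = 3 * m - 2 := by omega
      rw [show 2 * ((3 * m - 2) / 2) - 3 * m + 2 = 0 by omega]; ring
    · refine ⟨(3 * m - 1) / 2, ?_⟩
      unfold dpos
      rw [show 2 * ((3 * m - 1) / 2) - 3 * m + 2 = 1 by omega]; ring

/-- The doubled position `2·t(ℓ,u)` is the centre `b₀ + 2` iff `dpos = 0`. -/
theorem two_mul_tOf_eq_centre_iff (hc : (u - R0b p m b0) % 2 = 0) :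
    2 * tOf p m b0 ℓ u = b0 + 2 ↔ dpos p m ℓ u = 0 := by
  have := two_mul_tOf hc ℓ; constructor <;> intro h <;> linarith

/-- a b-coordinate deep cell (Part I's `BCell` with `q = (m−1)p`) satisfies the level box in b-coordinates. -/
theorem BCell.levelBox' {p m b0 : ℤ} {b : Fin 7 → ℤ} (h : BCell p ((m - 1) * p) b0 b) :
    LevelBox p (R0b p m b0) (rhob p m b0 b) := by
  rw [rhob_eq_rhoOf, R0b_eq_R0Of]; exact h.deepCell.levelBox

end Census

/-! ### Kernel examples on real cells (the four rows of the table that differ from Theorem S (i) as printed, and the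
dictionary on the standing (1,11) cell) -/

section CensusExamples

/-- (1,11) cell `b = (28; 10,9,9,8,7,7,7)` (`exRho`, `R₀ = 17`), dominant class `u = 1` (type `(L,R,n₊,n₋) = (3,1,0,0)`, δ = 4):
excess `3, 1` at the pole edges `ℓ = 0, 1`, nothing at `ℓ = −1, 2`; its level-0 integer is `t(0,1) = 9`, which lies in
exactly the four blocks `[9,21], [8,22], [8,22], [8,22]` (= `7 − L`) and in the numerator. -/
example : excess 11 17 1 exRho 0 1 = 3 ∧ excess 11 17 1 exRho 1 1 = 1 ∧ excess 11 17 1 exRho (-1) 1 = 0 ∧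
    excess 11 17 1 exRho 2 1 = 0 ∧ tOf 11 1 28 0 1 = 9 ∧ nBlocks 11 1 exRho 0 1 = 4 := by decide

/-- the same cell read at octave `m = 3` (`b ↦ (94; 32,31,31,30,29,29,29)`, same `ρ, R₀`): the SAME excesses now sit at
`ℓ = 2, 5` (pole edges `m−1, 2m−1`), the interior pole levels `3, 4` and the zero frame `0, 1, 6, 7` carry none. -/
example : excess 11 17 3 exRho 2 1 = 3 ∧ excess 11 17 3 exRho 5 1 = 1 ∧ excess 11 17 3 exRho 3 1 = 0 ∧
    excess 11 17 3 exRho 4 1 = 0 ∧ excess 11 17 3 exRho 0 1 = 0 ∧ excess 11 17 3 exRho 1 1 = 0 ∧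
    excess 11 17 3 exRho 6 1 = 0 ∧ excess 11 17 3 exRho 7 1 = 0 ∧ excess 11 17 3 exRho (-1) 1 = 0 ∧
    excess 11 17 3 exRho 8 1 = 0 := by decide

/-- **A1 in action** — (1,11) cell `b = (37; 16,16,10,10,10,10,7)`, `ρ = (5,5,17,17,17,17,23)`, `R₀ = 26`, class `u = −10`:
the printed `n₋ = [u ≤ R₀−2p] = 1`, but the long block (`ρ₇ = 23 ≥ 3p+u`) reaches level `−1` and cancels the extra zero:
excess `0` there (`t(−1,−10) = 8 ∈ [8,31]`). -/
def a1Rho : Fin 7 → ℤ := ![5, 5, 17, 17, 17, 17, 23]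

example : nm 11 26 (-10) = 1 ∧ reachL 11 a1Rho (-10) = 1 ∧ excess 11 26 1 a1Rho (-1) (-10) = 0 ∧
    tOf 11 1 37 (-1) (-10) = 8 := by decide

/-- **A2 in action** — (1,11) cell `b = (20; 8,8,8,1,1,1,1)`, `ρ = (4,4,4,18,18,18,18)`, `R₀ = 9`, class `u = 11 > R₀`:
all seven blocks miss level 0 (`L = 7`) but so does the numerator (`t(0,11) = 0 ∉ [1,21]`): excess `6 = 7 − 1`, not 7. -/
def a2Rho : Fin 7 → ℤ := ![4, 4, 4, 18, 18, 18, 18]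

example : L 11 a2Rho 11 = 7 ∧ excess 11 9 1 a2Rho 0 11 = 6 ∧ tOf 11 1 20 0 11 = 0 := by decide

/-- **INADMISSIBILITY at `m = 2`, numerator-short** — (2,13) cell `b = (63; 23,23,23,14,14,14,14)`, `R₀ = 11`, class `u = 13 > R₀`:
the zero-frame level 0 is OVER-COVERED (excess `−1`: `t(0,13) = 0` is outside the numerator `[1,64]`). -/
example : excess 13 11 2 a2Rho 0 13 = -1 ∧ tOf 13 2 63 0 13 = 0 := by decide

/-- **INADMISSIBILITY at `m = 2`, a block beyond the pole frame** — (2,13) cell `b = (84; 33,33,25,25,25,25,22)`,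
`ρ = (5,5,21,21,21,21,27)`, `R₀ = 32`, class `u = −12`: the block of `b₇ = 22` (`ρ₇ = 27 ≥ 3p+u`) covers the zero-frame
level 0 (`t(0,−12) = 23 ∈ [23,63]`): excess `−1` — the same event that was A1 at `m = 1`. -/
def reachRho : Fin 7 → ℤ := ![5, 5, 21, 21, 21, 21, 27]

example : reachL 13 reachRho (-12) = 1 ∧ excess 13 32 2 reachRho 0 (-12) = -1 ∧ tOf 13 2 84 0 (-12) = 23 := by decide

/-- S3a on the standing cell: the dominant class `u = 1` carries `4m + 8 − δ = 8` net poles at `m = 1` (levels `−1 … 2`)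
and `16` at `m = 3` (levels `−1 … 8`). -/
example : (∑ ℓ ∈ Finset.Icc (-1 : ℤ) 2, ord 11 17 1 exRho ℓ 1) = 8 ∧
    (∑ ℓ ∈ Finset.Icc (-1 : ℤ) 8, ord 11 17 3 exRho ℓ 1) = 16 := by decide

/-- centre-zero vs centre: at `p = 11`, `m = 1` the class `u = 11 = p` contains the centre (`d(1,11) = 0`), at `m = 2` the
class `u = 0` does (`d(2,0) = 0`); `u = 0` at odd `m` never does (`b₀` odd there). -/
example : dpos 11 1 1 11 = 0 ∧ dpos 11 2 2 0 = 0 ∧ (∀ ℓ ∈ Finset.Icc (-3 : ℤ) 6, dpos 11 1 ℓ 0 ≠ 0) := by decide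

end CensusExamples

end Summit.KontsevichZagierPeriods.Zeta5Search.DenomLaw.ThresholdModel.Rho
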